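import Literature.AlgebraicGeometry.Motives.MixedHodgeStructureRadical
import Literature.AlgebraicGeometry.Motives.MixedHodgeStructureGrWSubquotients
import HarnessLib

/-!
# Socle and radical of a mixed Hodge structure under duality; weight bounds

Fujiki, *Duality of mixed Hodge structures* (1.6.2): `H ↦ H^∨` is an exact anti-equivalence on mixed
`ℚ`-Hodge structures, sub-MHS `S ⊆ H` correspond to their orthogonals `S^⊥ ⊆ H^∨` with `(H/S)^∨ ≅ S^⊥`,
`S^∨ ≅ H^∨/S^⊥`. Consequently the largest semisimple sub-object (the socle, `MixedHodgeStructureSocle`) and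
the smallest sub-object with semisimple quotient (the radical, `MixedHodgeStructureRadical`) — notions of the
abelian category of MHS (Cattani–El Zein–Griffiths–Lê, Thm. 3.2.18, p. 270) — are exchanged by `⊥`.
Namespace `MixedHodgeStructure`; everything proved, no named facts:

* §1 the orthogonal **`S'.coannihilator ⊆ H`** of a sub-MHS `S' ⊆ H^∨` (preimage of `S'^⊥` under
  `i_V : H ⥲ H^∨∨`), the double-orthogonal identities `annihilator_coannihilator`, `coannihilator_annihilator`,
  order reversal, dimension count.
* §2 semisimplicity across the dualities: `isSemisimple_annihilator_iff` (`S^⊥` semisimple iff `H/S` is),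
  `isSemisimple_annihilator_quotient_iff`, `isSemisimple_coannihilator_iff`, `isSemisimple_coannihilator_quotient_iff`.
* §3 **`annihilator_radical : (rad H)^⊥ = soc(H^∨)`**, **`annihilator_socle : (soc H)^⊥ = rad(H^∨)`**, the
  `coannihilator` forms and `dim rad H + dim soc H^∨ = dim H`.
* §4 graded-polarizable weight bounds (Jannsen, Thm. 7.9 (proof): the `Gr^W_n` are semisimple): the lowest weight
  step is in the socle (`IsGradedPolarizable.W_le_socle`), the radical is in the next-to-top weight step
  (`IsGradedPolarizable.radical_le_W`); with only two weights `rad H ⊆ soc H` (Loewy length `≤ 2`).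

## References

* [Fujiki1980] A. Fujiki, Duality of mixed Hodge structures of algebraic varieties, Publ. RIMS 16 (1980), (1.6.2).
* [CattaniElZeinGriffithsLe2014] E. Cattani et al. (eds.), Hodge Theory (2014), Thm. 3.2.18, Lemma 3.2.20, p. 270.
* [Jannsen1990MixedMotives] U. Jannsen, Mixed Motives and Algebraic K-Theory, LNM 1400 (1990), Thm. 7.9.
-/

noncomputable section

namespace Literature.AlgebraicGeometry.Motives

namespace MixedHodgeStructure

universe u

variable {V : Type u} [AddCommGroup V] [Module ℚ V] [FiniteDimensional ℚ V]
variable {H : MixedHodgeStructure V}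

open Module

/-! ### §1 The orthogonal `S'_⊥ ⊆ H` of a sub-MHS `S' ⊆ H^∨` -/

namespace SubMixedHodgeStructure

/-- **The orthogonal `S'_⊥ = {x ∈ H | φ(x) = 0 for all φ ∈ S'}` of a sub-MHS `S' ⊆ H^∨`**, a sub-MHS of `H`: the
preimage of `S'^⊥ ⊆ H^∨∨` under the isomorphism `i_V : H ⥲ H^∨∨`. [cite: Fujiki1980, (1.6.2) a), b)] -/
def coannihilator (S' : SubMixedHodgeStructure H.dual) : SubMixedHodgeStructure H :=
  S'.annihilator.comap (Hom.bidual H)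

/-- The underlying subspace of `S'.coannihilator` is Mathlib's `dualCoannihilator`. [cite: Fujiki1980, (1.6.2) b)] -/
theorem coannihilator_toSubmodule (S' : SubMixedHodgeStructure H.dual) :
    S'.coannihilator.toSubmodule = S'.toSubmodule.dualCoannihilator := by
  rw [coannihilator, comap_toSubmodule, annihilator_toSubmodule, Hom.bidual_toLinearMap]
  rfl

/-- Membership in `S'_⊥`. [cite: Fujiki1980, (1.6.2) b)] -/
theorem mem_coannihilator_iff (S' : SubMixedHodgeStructure H.dual) (x : V) :
    x ∈ S'.coannihilator.toSubmodule ↔ ∀ φ ∈ S'.toSubmodule, φ x = 0 := by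
  rw [coannihilator_toSubmodule, Submodule.mem_dualCoannihilator]

/-- **`(S'_⊥)^⊥ = S'`.** [cite: Fujiki1980, (1.6.2) b)] -/
theorem annihilator_coannihilator (S' : SubMixedHodgeStructure H.dual) : S'.coannihilator.annihilator = S' :=
  ext (by rw [annihilator_toSubmodule, coannihilator_toSubmodule, Subspace.dualCoannihilator_dualAnnihilator_eq])

/-- **`(S^⊥)_⊥ = S`.** [cite: Fujiki1980, (1.6.2) b)] -/
theorem coannihilator_annihilator (S : SubMixedHodgeStructure H) : S.annihilator.coannihilator = S :=
  ext (by rw [coannihilator_toSubmodule, annihilator_toSubmodule]; exact Subspace.dualAnnihilator_dualCoannihilator_eq)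

/-- `S' ↦ S'_⊥` reverses inclusions. [cite: Fujiki1980, (1.6.2) b)] -/
theorem coannihilator_le_coannihilator_iff (S' T' : SubMixedHodgeStructure H.dual) :
    S'.coannihilator.toSubmodule ≤ T'.coannihilator.toSubmodule ↔ T'.toSubmodule ≤ S'.toSubmodule := by
  constructor
  · intro h
    have h' := (annihilator_le_annihilator_iff T'.coannihilator S'.coannihilator).2 h
    rwa [annihilator_coannihilator, annihilator_coannihilator] at h'
  · intro h
    rw [coannihilator_toSubmodule, coannihilator_toSubmodule]
    exact Submodule.dualCoannihilator_anti h

/-- `S'_⊥ = T'_⊥ ↔ S' = T'`. [cite: Fujiki1980, (1.6.2) b)] -/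
theorem coannihilator_inj {S' T' : SubMixedHodgeStructure H.dual} : S'.coannihilator = T'.coannihilator ↔ S' = T' :=
  ⟨fun h => by rw [← annihilator_coannihilator S', h, annihilator_coannihilator], fun h => h ▸ rfl⟩

/-- `S^⊥ = T^⊥ ↔ S = T`. [cite: Fujiki1980, (1.6.2) b)] -/
theorem annihilator_inj {S T : SubMixedHodgeStructure H} : S.annihilator = T.annihilator ↔ S = T :=
  ⟨fun h => by rw [← coannihilator_annihilator S, h, coannihilator_annihilator], fun h => h ▸ rfl⟩

/-- `(H^∨)_⊥ = 0`. [cite: Fujiki1980, (1.6.2) b)] -/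
theorem coannihilator_top : (top H.dual).coannihilator = bot H :=
  ext (by rw [coannihilator_toSubmodule, top_toSubmodule, bot_toSubmodule, Submodule.dualCoannihilator_top])

/-- `0_⊥ = H`. [cite: Fujiki1980, (1.6.2) b)] -/
theorem coannihilator_bot : (bot H.dual).coannihilator = top H :=
  ext (by rw [coannihilator_toSubmodule, top_toSubmodule, bot_toSubmodule, Submodule.dualCoannihilator_bot])

/-- `dim S + dim S^⊥ = dim H`. [cite: Fujiki1980, (1.6.2) b)] -/
theorem finrank_add_finrank_annihilator (S : SubMixedHodgeStructure H) :
    finrank ℚ S.toSubmodule + finrank ℚ S.annihilator.toSubmodule = finrank ℚ V := by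
  rw [annihilator_toSubmodule]
  exact Subspace.finrank_add_finrank_dualAnnihilator_eq _

/-- `dim S' + dim S'_⊥ = dim H`. [cite: Fujiki1980, (1.6.2) b)] -/
theorem finrank_add_finrank_coannihilator (S' : SubMixedHodgeStructure H.dual) :
    finrank ℚ S'.toSubmodule + finrank ℚ S'.coannihilator.toSubmodule = finrank ℚ V := by
  rw [coannihilator_toSubmodule]
  exact Subspace.finrank_add_finrank_dualCoannihilator_eq _

/-! ### §2 Semisimplicity across `(H/S)^∨ ≅ S^⊥` and `S^∨ ≅ H^∨/S^⊥` -/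

/-- **`S^⊥` is semisimple iff `H/S` is** (`(H/S)^∨ ≅ S^⊥`, and `M` is semisimple iff `M^∨` is).
[cite: Fujiki1980, (1.6.2) b)] [cite: CattaniElZeinGriffithsLe2014, Thm. 3.2.18 and p. 270] -/
theorem isSemisimple_annihilator_iff (S : SubMixedHodgeStructure H) :
    S.annihilator.toMixedHodgeStructure.IsSemisimple ↔ S.quotient.IsSemisimple :=
  (isSemisimple_iff_of_bijective S.quotientDualHom S.quotientDualHom_bijective).symm.trans isSemisimple_dual_iff

/-- **`H^∨/S^⊥` is semisimple iff `S` is** (`H^∨/S^⊥ ≅ S^∨`). [cite: Fujiki1980, (1.6.2) b)]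
[cite: CattaniElZeinGriffithsLe2014, Thm. 3.2.18 and p. 270] -/
theorem isSemisimple_annihilator_quotient_iff (S : SubMixedHodgeStructure H) :
    S.annihilator.quotient.IsSemisimple ↔ S.toMixedHodgeStructure.IsSemisimple :=
  (isSemisimple_iff_of_bijective S.dualQuotientHom S.dualQuotientHom_bijective).trans isSemisimple_dual_iff

/-- `S'_⊥` is semisimple iff `H^∨/S'` is (`(S'_⊥)^∨ ≅ H^∨/S'`). [cite: Fujiki1980, (1.6.2) b)]
[cite: CattaniElZeinGriffithsLe2014, Thm. 3.2.18 and p. 270] -/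
theorem isSemisimple_coannihilator_iff (S' : SubMixedHodgeStructure H.dual) :
    S'.coannihilator.toMixedHodgeStructure.IsSemisimple ↔ S'.quotient.IsSemisimple := by
  have h := isSemisimple_annihilator_quotient_iff S'.coannihilator
  rw [annihilator_coannihilator] at h
  exact h.symm

/-- `H/S'_⊥` is semisimple iff `S'` is (`(H/S'_⊥)^∨ ≅ S'`). [cite: Fujiki1980, (1.6.2) b)]
[cite: CattaniElZeinGriffithsLe2014, Thm. 3.2.18 and p. 270] -/
theorem isSemisimple_coannihilator_quotient_iff (S' : SubMixedHodgeStructure H.dual) :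
    S'.coannihilator.quotient.IsSemisimple ↔ S'.toMixedHodgeStructure.IsSemisimple := by
  have h := isSemisimple_annihilator_iff S'.coannihilator
  rw [annihilator_coannihilator] at h
  exact h.symm

end SubMixedHodgeStructure

/-! ### §3 `(rad H)^⊥ = soc(H^∨)` and `(soc H)^⊥ = rad(H^∨)` -/

open SubMixedHodgeStructure in
/-- **The orthogonal of the radical is the socle of the dual**: `(rad H)^⊥ ≅ (H/rad H)^∨` is semisimple, so inside
`soc(H^∨)`; and `H/soc(H^∨)_⊥` (dual to `soc(H^∨)`) is semisimple, so `rad H ⊆ soc(H^∨)_⊥`, i.e. `soc(H^∨) ⊆ (rad H)^⊥`.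
[cite: Fujiki1980, (1.6.2) b)] [cite: CattaniElZeinGriffithsLe2014, Thm. 3.2.18 and p. 270] -/
theorem annihilator_radical : (radical H).annihilator = socle H.dual := by
  refine SubMixedHodgeStructure.ext (le_antisymm ?_ ?_)
  · exact le_socle _ ((isSemisimple_annihilator_iff _).2 (isSemisimple_quotient_radical H))
  · have h1 : (radical H).toSubmodule ≤ (socle H.dual).coannihilator.toSubmodule :=
      radical_le _ ((isSemisimple_coannihilator_quotient_iff _).2 (isSemisimple_socle H.dual))
    have h2 := (annihilator_le_annihilator_iff (socle H.dual).coannihilator (radical H)).2 h1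
    rwa [annihilator_coannihilator] at h2

open SubMixedHodgeStructure in
/-- **The orthogonal of the socle is the radical of the dual**: `H^∨/(soc H)^⊥ ≅ (soc H)^∨` is semisimple, so
`rad(H^∨) ⊆ (soc H)^⊥`; and `rad(H^∨)_⊥` (dual to `H^∨/rad(H^∨)`) is semisimple, so inside `soc H`, whence
`(soc H)^⊥ ⊆ rad(H^∨)`. [cite: Fujiki1980, (1.6.2) b)] [cite: CattaniElZeinGriffithsLe2014, Thm. 3.2.18 and p. 270] -/
theorem annihilator_socle : (socle H).annihilator = radical H.dual := by
  refine SubMixedHodgeStructure.ext (le_antisymm ?_ ?_)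
  · have h1 : (radical H.dual).coannihilator.toSubmodule ≤ (socle H).toSubmodule :=
      le_socle _ ((isSemisimple_coannihilator_iff _).2 (isSemisimple_quotient_radical H.dual))
    have h2 := (annihilator_le_annihilator_iff (socle H) (radical H.dual).coannihilator).2 h1
    rwa [annihilator_coannihilator] at h2
  · exact radical_le _ ((isSemisimple_annihilator_quotient_iff _).2 (isSemisimple_socle H))

/-- `soc(H^∨)_⊥ = rad H`. [cite: Fujiki1980, (1.6.2) b)] [cite: CattaniElZeinGriffithsLe2014, p. 270] -/
theorem coannihilator_socle : (socle H.dual).coannihilator = radical H := by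
  rw [← annihilator_radical, SubMixedHodgeStructure.coannihilator_annihilator]

/-- `rad(H^∨)_⊥ = soc H`. [cite: Fujiki1980, (1.6.2) b)] [cite: CattaniElZeinGriffithsLe2014, p. 270] -/
theorem coannihilator_radical : (radical H.dual).coannihilator = socle H := by
  rw [← annihilator_socle, SubMixedHodgeStructure.coannihilator_annihilator]

/-- `dim rad H + dim soc(H^∨) = dim H`. [cite: Fujiki1980, (1.6.2) b)] -/
theorem finrank_radical_add_finrank_socle_dual :
    finrank ℚ (radical H).toSubmodule + finrank ℚ (socle H.dual).toSubmodule = finrank ℚ V := by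
  rw [← annihilator_radical]
  exact SubMixedHodgeStructure.finrank_add_finrank_annihilator _

/-- `dim soc H + dim rad(H^∨) = dim H`. [cite: Fujiki1980, (1.6.2) b)] -/
theorem finrank_socle_add_finrank_radical_dual :
    finrank ℚ (socle H).toSubmodule + finrank ℚ (radical H.dual).toSubmodule = finrank ℚ V := by
  rw [← annihilator_socle]
  exact SubMixedHodgeStructure.finrank_add_finrank_annihilator _

/-- `rad H = 0 ↔ soc(H^∨) = H^∨` (both say: `H`, equivalently `H^∨`, is semisimple). [cite: Fujiki1980, (1.6.2) b)]
[cite: CattaniElZeinGriffithsLe2014, p. 270] -/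
theorem radical_eq_bot_iff_socle_dual_eq_top :
    (radical H).toSubmodule = ⊥ ↔ (socle H.dual).toSubmodule = ⊤ := by
  rw [radical_eq_bot_iff, socle_eq_top_iff, isSemisimple_dual_iff]

/-! ### §4 Weight bounds in the graded-polarizable case -/

/-- **The lowest weight step of a graded-polarizable MHS is a semisimple sub-MHS** (it is pure and polarizable).
[cite: Jannsen1990MixedMotives, Thm. 7.9 (proof)] -/
theorem IsGradedPolarizable.isSemisimple_weight (hp : H.IsGradedPolarizable) {n : ℤ} (hn : H.W (n - 1) = ⊥) :
    (SubMixedHodgeStructure.weight H n).toMixedHodgeStructure.IsSemisimple :=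
  (hp.of_injective (SubMixedHodgeStructure.weight H n).subtype
      (Submodule.injective_subtype _)).isSemisimple_of_forall_W_eq_bot_or_eq_top fun k => by
    rcases le_or_gt n k with hk | hk
    · exact Or.inr (SubMixedHodgeStructure.weight_toMixedHodgeStructure_W_of_le H hk)
    · refine Or.inl (eq_bot_iff.2 fun x hx => ?_)
      have hx' : (x : V) ∈ H.W (n - 1) := H.monotone_W (show k ≤ n - 1 by omega) hx
      rw [hn, Submodule.mem_bot, Submodule.coe_eq_zero] at hx'
      rw [hx']
      exact Submodule.zero_mem _

/-- **`W_n H ⊆ soc H` when `W_{n-1} H = 0`** (graded-polarizable `H`). [cite: Jannsen1990MixedMotives, Thm. 7.9 (proof)]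
[cite: CattaniElZeinGriffithsLe2014, p. 270] -/
theorem IsGradedPolarizable.W_le_socle (hp : H.IsGradedPolarizable) {n : ℤ} (hn : H.W (n - 1) = ⊥) :
    H.W n ≤ (socle H).toSubmodule :=
  le_socle (SubMixedHodgeStructure.weight H n) (hp.isSemisimple_weight hn)

/-- **The top graded quotient `H / W_{n-1} H` (`W_n H = H`) of a graded-polarizable MHS is semisimple.**
[cite: Jannsen1990MixedMotives, Thm. 7.9 (proof)] -/
theorem IsGradedPolarizable.isSemisimple_weight_quotient (hp : H.IsGradedPolarizable) {n : ℤ} (hn : H.W n = ⊤) :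
    (SubMixedHodgeStructure.weight H (n - 1)).quotient.IsSemisimple :=
  (hp.of_surjective (SubMixedHodgeStructure.weight H (n - 1)).mkQ
      (Submodule.mkQ_surjective _)).isSemisimple_of_forall_W_eq_bot_or_eq_top fun k => by
    rcases le_or_gt k (n - 1) with hk | hk
    · exact Or.inl (SubMixedHodgeStructure.weight_quotient_W_of_le H hk)
    · refine Or.inr ?_
      have hk' : H.W k = ⊤ := eq_top_iff.2 (by rw [← hn]; exact H.monotone_W (show n ≤ k by omega))
      rw [SubMixedHodgeStructure.quotient_W, hk', Submodule.map_top, Submodule.range_mkQ]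

/-- **`rad H ⊆ W_{n-1} H` when `W_n H = H`** (graded-polarizable `H`). [cite: Jannsen1990MixedMotives, Thm. 7.9 (proof)]
[cite: CattaniElZeinGriffithsLe2014, p. 270] -/
theorem IsGradedPolarizable.radical_le_W (hp : H.IsGradedPolarizable) {n : ℤ} (hn : H.W n = ⊤) :
    (radical H).toSubmodule ≤ H.W (n - 1) :=
  radical_le (SubMixedHodgeStructure.weight H (n - 1)) (hp.isSemisimple_weight_quotient hn)

/-- **Two weights: `rad H ⊆ W_{n-1} H ⊆ soc H`** for a graded-polarizable `H` with `W_{n-2} H = 0`, `W_n H = H`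
(an extension of two pure polarizable Hodge structures has Loewy length `≤ 2`).
[cite: Jannsen1990MixedMotives, Thm. 7.9 (proof)] [cite: CattaniElZeinGriffithsLe2014, p. 270] -/
theorem IsGradedPolarizable.radical_le_socle_of_two_weights (hp : H.IsGradedPolarizable) {n : ℤ}
    (h₁ : H.W (n - 2) = ⊥) (h₂ : H.W n = ⊤) : (radical H).toSubmodule ≤ (socle H).toSubmodule :=
  (hp.radical_le_W h₂).trans (hp.W_le_socle (by rw [show n - 1 - 1 = n - 2 by ring]; exact h₁))

/-- Two weights: `H / soc H` is semisimple. [cite: Jannsen1990MixedMotives, Thm. 7.9 (proof)]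
[cite: CattaniElZeinGriffithsLe2014, p. 270] -/
theorem IsGradedPolarizable.isSemisimple_socle_quotient_of_two_weights (hp : H.IsGradedPolarizable) {n : ℤ}
    (h₁ : H.W (n - 2) = ⊥) (h₂ : H.W n = ⊤) : (socle H).quotient.IsSemisimple :=
  (isSemisimple_quotient_iff_radical_le _).2 (hp.radical_le_socle_of_two_weights h₁ h₂)

/-- Two weights: `rad H` is a semisimple sub-MHS. [cite: Jannsen1990MixedMotives, Thm. 7.9 (proof)]
[cite: CattaniElZeinGriffithsLe2014, p. 270] -/
theorem IsGradedPolarizable.isSemisimple_radical_of_two_weights (hp : H.IsGradedPolarizable) {n : ℤ}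
    (h₁ : H.W (n - 2) = ⊥) (h₂ : H.W n = ⊤) : (radical H).toMixedHodgeStructure.IsSemisimple :=
  (isSemisimple_iff_le_socle _).2 (hp.radical_le_socle_of_two_weights h₁ h₂)

end MixedHodgeStructure

end Literature.AlgebraicGeometry.Motives
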